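import Summits.ValiantsHypothesis.ValiantsHypothesis.Theorems.DivisionGapPerDivisionHardStubTorus

/-!
# Crux `DivisionGap.PerDivisionHard` (stmt-ValiantsHypothesis-5065), line
`pair-descent-jss-endpoint` — stub `stub_topTransfer` (v15): the lex-top transfer

For every TORUS CHARACTER `w (i, j) = α i + β j` on the `n × n` matrix variables the permanent
`per_n ∈ ℝ≥0[x_ij]` is `w`-homogeneous of weight `Σ_i α i + Σ_j β j`: each permutation monomial
`x^{μ_π} = ∏_i x_{π i, i}` weighs `Σ_i (α (π i) + β i)`, and `i ↦ π i` is a bijection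
(`Equiv.sum_comp`).  Hence `top_w (per_n · h) = per_n · top_w h` (`topComponent_mul`,
`topComponent_eq_self_of_isWeightedHomogeneous`), and since initial forms are free for monotone
fan-in-two circuits over the semiring `ℝ≥0` (`complexity_topComponent_le`), passing from a
cofactor `h` to its top component `top_w h` can only lower both complexities of the pair:
`L(per_n · top_w h) ≤ L(per_n · h)` and `L(top_w h) ≤ L(h)`.  The torus normal form of
`stub_torus` (`Theorems/DivisionGapPerDivisionHardStubTorus.lean`) is the special case of the
two digit characters. [folklore]
-/

noncomputable section

-- `Summit.ValiantsHypothesis.ValiantsHypothesis.…` is the tree's mandated single-conjunct layout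
-- (Sub = Summit), so the duplicated namespace component is intended.
set_option linter.dupNamespace false

namespace Summit.ValiantsHypothesis.ValiantsHypothesis.Theorems.DivisionGapPerDivisionHard

open MvPolynomial Literature.Computability.AlgebraicComplexity
open Summit.ValiantsHypothesis.ValiantsHypothesis.Theorems.ZeroOneTransfer.Negative
open scoped NNReal

variable {n : ℕ}

/-! ### The permanent is homogeneous for every torus character -/

/-- Under the torus character `w (i, j) = α i + β j` the permutation monomial
`μ_π = Σ_i e_{(π i, i)}` weighs `Σ_i α i + Σ_j β j` (reindex `Σ_i α (π i)` along the bijection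
`π`). [folklore] -/
theorem weight_torusCharacter_permMonomial (α β : Fin n → ℕ) (π : Equiv.Perm (Fin n)) :
    Finsupp.weight (fun e : Fin n × Fin n => α e.1 + β e.2) (permMonomial π) =
      ∑ i : Fin n, α i + ∑ j : Fin n, β j := by
  classical
  rw [permMonomial, map_sum, ← Equiv.sum_comp π α, ← Finset.sum_add_distrib]
  refine Finset.sum_congr rfl fun i _ => ?_
  rw [Finsupp.weight_apply, Finsupp.sum_single_index (by simp)]
  simp

/-- **The permanent is homogeneous for every torus character** `w (i, j) = α i + β j`, of
weight `Σ_i α i + Σ_j β j`: it is the sum of the permutation monomials `x^{μ_π}`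
(`perPoly_eq_sum_monomial`), each of that weight (`weight_torusCharacter_permMonomial`).
[folklore] -/
theorem isWeightedHomogeneous_perPoly_torusCharacter (α β : Fin n → ℕ) :
    IsWeightedHomogeneous (fun e : Fin n × Fin n => α e.1 + β e.2) (perPoly (Fin n) ℝ≥0)
      (∑ i : Fin n, α i + ∑ j : Fin n, β j) := by
  classical
  rw [perPoly_eq_sum_monomial]
  refine IsWeightedHomogeneous.sum _ _ _ fun π _ => ?_
  exact isWeightedHomogeneous_monomial _ _ _ (weight_torusCharacter_permMonomial α β π)

/-- **Top components for a torus character commute with multiplication by the permanent**: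
`top_w (per_n · h) = per_n · top_w h` for `w (i, j) = α i + β j` (top components are
multiplicative over `ℝ≥0`, and the `w`-homogeneous permanent is its own top component).
[folklore] -/
theorem topComponent_torusCharacter_perPoly_mul (α β : Fin n → ℕ)
    (h : MvPolynomial (Fin n × Fin n) ℝ≥0) :
    topComponent (fun e : Fin n × Fin n => α e.1 + β e.2) (perPoly (Fin n) ℝ≥0 * h) =
      perPoly (Fin n) ℝ≥0 * topComponent (fun e : Fin n × Fin n => α e.1 + β e.2) h := by
  rw [topComponent_mul, topComponent_eq_self_of_isWeightedHomogeneous _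
    (isWeightedHomogeneous_perPoly_torusCharacter α β)]

/-! ### The stub -/

/-- **`stub_topTransfer` (v15 stub of line `pair-descent-jss-endpoint` for `PerDivisionHard`).**
For every TORUS CHARACTER `w (i, j) = α i + β j` the permanent is `w`-homogeneous (each
permutation monomial weighs `Σα + Σβ`: `Equiv.sum_comp`), so
`top_w (per_n · h) = per_n · top_w h` (`topComponent_mul`,
`topComponent_eq_self_of_isWeightedHomogeneous`) and both complexities of the pair can only drop
when `h` is replaced by `top_w h` (`complexity_topComponent_le`: initial forms are free for
monotone fan-in-two circuits over `ℝ≥0`).  The torus normal form of `stub_torus` is the special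
case of the two digit characters. [folklore] -/
theorem stub_topTransfer :
    ∀ (n : ℕ) (α β : Fin n → ℕ) (h : MvPolynomial (Fin n × Fin n) ℝ≥0),
      complexity (perPoly (Fin n) ℝ≥0 * topComponent (fun e : Fin n × Fin n => α e.1 + β e.2) h) ≤
          complexity (perPoly (Fin n) ℝ≥0 * h) ∧
        complexity (topComponent (fun e : Fin n × Fin n => α e.1 + β e.2) h) ≤ complexity h := by
  intro n α β h
  refine ⟨?_, complexity_topComponent_le _ h⟩
  have := complexity_topComponent_le (fun e : Fin n × Fin n => α e.1 + β e.2)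
    (perPoly (Fin n) ℝ≥0 * h)
  rwa [topComponent_torusCharacter_perPoly_mul α β h] at this

end Summit.ValiantsHypothesis.ValiantsHypothesis.Theorems.DivisionGapPerDivisionHard

end
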